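import Literature.NumberTheory.EllipticCurves.EisensteinSeriesNebentypus
import Literature.NumberTheory.EllipticCurves.HeckeOperators
import HarnessLib

/-!
# Constant terms of `E_k^χ` and of `E_k^χ(Mz)` at all cusps

Topic `Literature/NumberTheory/EllipticCurves`; namespace
`Literature.NumberTheory.EllipticCurves.ModularForms`.  THEOREMS ONLY (no definition, no named
fact).

Let `χ` be a Dirichlet character modulo `N ≥ 1`, `k ≥ 3`, and let
`E_k^χ = ∑_{u ∈ (ℤ/N)ˣ} χ(u)⁻¹ E_{k,(0,u)}` be the tree's Eisenstein series with nebentypus `χ`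
(`eisensteinChar N k χ`, `EisensteinSeriesNebentypus`; value `1 + χ(-1)(-1)^k` at `i∞`).  We
compute the value at `i∞` ("constant term of the Fourier expansion at `∞`") of

* `E_k^χ ∣_k γ` for every `γ = (a b; c d) ∈ SL₂(ℤ)` (`tendsto_eisensteinChar_slash_atImInfty`):
  it is `χ(d) (1 + χ(-1)(-1)^k)` if `N ∣ c` and `0` otherwise — Mathlib's
  `E_{k,(0,u)} ∣_k γ = E_{k,(0,u)γ}` (`eisensteinSeries_slash_apply`) and the value of the
  level-`Γ(N)` series `E_{k,v}` at `i∞` (`tendsto_eisensteinSeries_atImInfty`);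
* `(E_k^χ ∣_k α_M) ∣_k γ` for `α_M = diag(M, 1)` (`E_k^χ ∣_k α_M = M^{k-1} E_k^χ(Mz)`, the
  tree's degeneracy slash `glCast (diagGL M 1)`), `gcd(M, N) = 1`, in the two cases `M ∣ c`
  (`tendsto_eisensteinChar_slash_diagGL_slash_atImInfty_of_dvd`: the value is
  `M^{k-1} χ(d)(1 + χ(-1)(-1)^k) [N ∣ c]`) and `gcd(c, M) = 1`
  (`tendsto_eisensteinChar_slash_diagGL_slash_atImInfty_of_isCoprime`: the value is
  `M⁻¹ χ̄(M) χ(d)(1 + χ(-1)(-1)^k) [N ∣ c]`), which exhaust `SL₂(ℤ)` when `M` is prime.  The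
  mechanism is the factorisation `α_M γ = γ' α_M`, resp. `α_M γ = γ' diag(1, M) T^t`, with
  `γ' ∈ SL₂(ℤ)` having lower row `(c/M, d)`, resp. `(c, s)` with `s M ≡ d (mod c)`, and the rule
  `F ∣_k g → L (det g)^{k-1} δ^{-k}` at `i∞` for upper-triangular `g = (* *; 0 δ)`
  (`tendsto_slash_atImInfty_of_upperTriangular`).

Consequently (`tendsto_levelRaise_slash_atImInfty_of_dvd`, `…_of_isCoprime`) the combination
`F = E_k^χ - M^{1-k} (E_k^χ ∣_k α_M) = E_k^χ - E_k^χ(M ·)` has constant term `0` at the cusps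
`γ∞` with `M ∣ c`, and `χ(d)(1 + χ(-1)(-1)^k)(1 - χ̄(M) M^{-k}) [N ∣ c]` at those with
`gcd(c, M) = 1`.  This is Billerey–Menares, Prop. 4 and Cor. 5 (the factor
`(r/M)^k χ̄₁(r)χ₂(r)χ̄₂(M)`, `r = gcd(c, M) ∈ {1, M}`) for `χ₁ = 𝟙`, `χ₂ = χ`, `k ≥ 3`, in the
tree's normalisation (`E_k^χ` has constant term `2` rather than `-B_{k,χ}/2k`; the normalised
multiple `E_k^{𝟙,χ} = -(B_{k,χ}/4k) E_k^χ` is treated in `EisensteinSeriesNebentypusNormalised`),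
and it is the computation behind "`a_0(F_2 ∣_k γ) = Υ(γ,1)(1 - (r/M)^k (χ₁χ̄₂)(M/r))`" in the
proof of B–M Thm. 2 (§3.2).

## References

* N. Billerey, R. Menares, *Strong modularity of reducible Galois representations*, Trans. AMS
  370 (2018), §1.4 (Prop. 4, Cor. 5, Lemma 6), §3.2. [BillereyMenares2018]
* F. Diamond, J. Shurman, *A First Course in Modular Forms*, GTM 228 (2005), §4.2 (Thm. 4.2.3),
  §4.5–4.6, §5.7 (`[α_d]_k`). [DiamondShurman2005]
-/

noncomputable section

open ModularForm EisensteinSeries UpperHalfPlane CongruenceSubgroup Filter Matrix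
  Matrix.SpecialLinearGroup
open scoped MatrixGroups Topology

namespace Literature.NumberTheory.EllipticCurves.ModularForms

/-! ### Slashing by an upper-triangular matrix and the value at `i∞` -/

section UpperTriangular

variable {k : ℤ}

/-- **For `g = (a b; 0 δ) ∈ GL₂(ℝ)` of positive determinant and `F → L` at `i∞`,
`F ∣_k g → L · (det g)^{k-1} · δ^{-k}` at `i∞`** (`g` fixes the cusp `i∞`, Mathlib
`tendsto_smul_atImInfty`; Mathlib's slash carries the factor `|det g|^{k-1}`). [folklore] -/
theorem tendsto_slash_atImInfty_of_upperTriangular {F : ℍ → ℂ} {L : ℂ} {g : GL (Fin 2) ℝ}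
    (hg : g 1 0 = 0) (hdet : 0 < g.det.val) (hF : Tendsto F atImInfty (𝓝 L)) :
    Tendsto (F ∣[k] g) atImInfty
      (𝓝 (L * ((g.det.val : ℝ) : ℂ) ^ (k - 1) * ((g 1 1 : ℝ) : ℂ) ^ (-k))) := by
  have hσ : ∀ z, σ g z = z := fun z ↦ by rw [σ, if_pos hdet]; rfl
  have h : F ∣[k] g =
      fun τ ↦ F (g • τ) * ((g.det.val : ℝ) : ℂ) ^ (k - 1) * ((g 1 1 : ℝ) : ℂ) ^ (-k) := by
    funext τ
    rw [ModularForm.slash_apply, hσ, abs_of_pos hdet, denom]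
    simp [hg]
  rw [h]
  exact ((hF.comp (tendsto_smul_atImInfty hg)).mul_const _).mul_const _

/-- Slashing by an upper-triangular element of `SL₂(ℤ)` with lower-right entry `1` (a translation
`± T^t`) does not change the value at `i∞`. [folklore] -/
theorem tendsto_slash_SL2_atImInfty_of_upperTriangular {F : ℍ → ℂ} {L : ℂ} {γ : SL(2, ℤ)}
    (hγ : γ 1 0 = 0) (hγ' : γ 1 1 = 1) (hF : Tendsto F atImInfty (𝓝 L)) :
    Tendsto (F ∣[k] γ) atImInfty (𝓝 L) := by
  have h10 : (γ : GL (Fin 2) ℝ) 1 0 = 0 := by simp [hγ]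
  have hdet : 0 < (γ : GL (Fin 2) ℝ).det.val := by simp
  have h := tendsto_slash_atImInfty_of_upperTriangular (k := k) h10 hdet hF
  rw [ModularForm.SL_slash]
  convert h using 2
  simp [hγ']

end UpperTriangular

/-! ### The constant term of `E_k^χ ∣ γ` at every cusp -/

section EisensteinChar

variable {N : ℕ} [NeZero N] {k : ℤ} (χ : DirichletCharacter ℂ N)

omit [NeZero N] in
/-- The first entry of `(0, u) γ` is `u c` (`γ = (a b; c d)`). [folklore] -/
theorem vecMul_SL2_apply_zero (γ : SL(2, ℤ)) (u : ZMod N) :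
    ((![0, u] : Fin 2 → ZMod N) ᵥ* γ) (0 : Fin 2) = u * ((γ 1 0 : ℤ) : ZMod N) := by
  simp [Matrix.vecMul, dotProduct, Fin.sum_univ_two]

omit [NeZero N] in
/-- The level-`Γ(N)` series `E_{k,(0,u)γ}` vanishes at `i∞` when `N ∤ c` (`u` a unit): its
index vector `(uc, ud)` has nonzero first entry. [cite: DiamondShurman2005, §4.2 (Thm. 4.2.3)] -/
theorem eisCuspValue_vecMul_eq_zero {γ : SL(2, ℤ)} (hc : ((γ 1 0 : ℤ) : ZMod N) ≠ 0)
    (u : (ZMod N)ˣ) : eisCuspValue ((![0, (u : ZMod N)] : Fin 2 → ZMod N) ᵥ* γ) k = 0 := by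
  have hne : ((![0, (u : ZMod N)] : Fin 2 → ZMod N) ᵥ* γ) (0 : Fin 2) ≠ 0 := by
    rw [vecMul_SL2_apply_zero]
    intro h0
    apply hc
    have := congrArg (fun x ↦ ((u⁻¹ : (ZMod N)ˣ) : ZMod N) * x) h0
    simpa [← mul_assoc] using this
  simp only [eisCuspValue]
  rw [if_neg, if_neg, add_zero]
  · intro h
    exact hne (by rw [← h]; simp)
  · intro h
    exact hne (by rw [← h]; simp)

/-- **The constant term of `E_k^χ ∣_k γ` at `i∞`, for every `γ = (a b; c d) ∈ SL₂(ℤ)`**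
(`k ≥ 3`): it is `χ(d)(1 + χ(-1)(-1)^k)` if `N ∣ c` (then `γ ∈ Γ₀(N)` and
`E_k^χ ∣_k γ = χ(d) E_k^χ`) and `0` if `N ∤ c` (every `E_{k,(0,u)γ} = E_{k,(uc,ud)}` vanishes at
`i∞`).  This is Billerey–Menares Prop. 4 with `M = 1`, `χ₁ = 𝟙`, in the tree's normalisation
(constant term `2` instead of `-B_{k,χ}/2k`). [cite: BillereyMenares2018, Prop. 4; DiamondShurman2005, §4.2, §4.5–4.6] -/
theorem tendsto_eisensteinChar_slash_atImInfty (hk : 3 ≤ k) (γ : SL(2, ℤ)) :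
    Tendsto (eisensteinChar N k χ ∣[k] γ) atImInfty
      (𝓝 (if ((γ 1 0 : ℤ) : ZMod N) = 0 then
        χ ((γ 1 1 : ℤ) : ZMod N) * (1 + χ (-1) * (-1) ^ k) else 0)) := by
  by_cases hc : ((γ 1 0 : ℤ) : ZMod N) = 0
  · rw [if_pos hc, eisensteinChar_slash_of_mem_gamma0 (Gamma0_mem.2 hc)]
    have h := (tendsto_eisensteinChar_atImInfty (N := N) (χ := χ) hk).const_mul
      (χ ((γ 1 1 : ℤ) : ZMod N))
    convert h using 1
    funext x
    simp [smul_eq_mul]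
  · rw [if_neg hc, eisensteinChar_eq_sum, SlashAction.sum_slash]
    simp_rw [ModularForm.SL_smul_slash, eisensteinSeries_slash_apply]
    have hfun : (∑ u : (ZMod N)ˣ, χ ((u⁻¹ : (ZMod N)ˣ) : ZMod N) •
        eisensteinSeries (((![0, (u : ZMod N)] : Fin 2 → ZMod N) ᵥ* γ)) k) =
        fun z ↦ ∑ u : (ZMod N)ˣ, χ ((u⁻¹ : (ZMod N)ˣ) : ZMod N) *
          eisensteinSeries (((![0, (u : ZMod N)] : Fin 2 → ZMod N) ᵥ* γ)) k z := by
      funext z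
      simp [Finset.sum_apply]
    rw [hfun]
    have h := tendsto_finsetSum (Finset.univ : Finset (ZMod N)ˣ) fun u _ ↦
      (tendsto_eisensteinSeries_atImInfty hk
        (((![0, (u : ZMod N)] : Fin 2 → ZMod N) ᵥ* γ))).const_mul
        (χ ((u⁻¹ : (ZMod N)ˣ) : ZMod N))
    simp only [eisCuspValue_vecMul_eq_zero hc, mul_zero, Finset.sum_const_zero] at h
    exact h

end EisensteinChar

/-! ### The degeneracy slash `α_M = diag(M, 1)` followed by `γ ∈ SL₂(ℤ)` -/

section Degeneracy

variable {N : ℕ} [NeZero N] {k : ℤ} (χ : DirichletCharacter ℂ N) (M : ℕ) [NeZero M]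

omit [NeZero N] in
/-- **`α_M γ = γ' α_M` when `M ∣ c`**: `diag(M,1) (a b; Mc₁ d) = (a, Mb; c₁, d) diag(M,1)` in
`GL₂(ℝ)`. [folklore] -/
theorem glCast_diagGL_mul_mapGL_of_dvd (a b c₁ d : ℤ) (h : (!![a, b; (M : ℤ) * c₁, d]).det = 1)
    (h' : (!![a, (M : ℤ) * b; c₁, d]).det = 1) :
    glCast ((diagGL (M : ℚ) 1 (Nat.cast_pos.mpr (NeZero.pos M)) one_pos : GL(2, ℚ)⁺) :
        GL (Fin 2) ℚ) * mapGL ℝ (⟨!![a, b; (M : ℤ) * c₁, d], h⟩ : SL(2, ℤ)) =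
      mapGL ℝ (⟨!![a, (M : ℤ) * b; c₁, d], h'⟩ : SL(2, ℤ)) *
        glCast ((diagGL (M : ℚ) 1 (Nat.cast_pos.mpr (NeZero.pos M)) one_pos : GL(2, ℚ)⁺) :
          GL (Fin 2) ℚ) := by
  ext i j
  fin_cases i <;> fin_cases j <;>
    simp [mapGL, Matrix.mul_apply, Fin.sum_univ_two, glCast, diagGL] <;> ring

omit [NeZero N] in
/-- **`α_M γ = γ' diag(1, M) T^t` when `gcd(c, M) = 1`**: with `x c + y M = 1` and `t = x d`,
`diag(M,1) (a b; c d) = (Ma, b - at; c, dy) · diag(1, M) · (1 t; 0 1)` in `GL₂(ℝ)`. [folklore] -/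
theorem glCast_diagGL_mul_mapGL_of_isCoprime (a b c d x y : ℤ) (h : (!![a, b; c, d]).det = 1)
    (hxy : x * c + y * M = 1) (h' : (!![(M : ℤ) * a, b - a * (x * d); c, d * y]).det = 1)
    (hT : (!![(1 : ℤ), x * d; 0, 1]).det = 1) :
    glCast ((diagGL (M : ℚ) 1 (Nat.cast_pos.mpr (NeZero.pos M)) one_pos : GL(2, ℚ)⁺) :
        GL (Fin 2) ℚ) * mapGL ℝ (⟨!![a, b; c, d], h⟩ : SL(2, ℤ)) =
      mapGL ℝ (⟨!![(M : ℤ) * a, b - a * (x * d); c, d * y], h'⟩ : SL(2, ℤ)) *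
        glCast ((diagGL 1 (M : ℚ) one_pos (Nat.cast_pos.mpr (NeZero.pos M)) : GL(2, ℚ)⁺) :
          GL (Fin 2) ℚ) * mapGL ℝ (⟨!![(1 : ℤ), x * d; 0, 1], hT⟩ : SL(2, ℤ)) := by
  have hxy' : (x : ℝ) * c + y * M = 1 := by exact_mod_cast hxy
  ext i j
  fin_cases i <;> fin_cases j <;>
    simp [mapGL, Matrix.mul_apply, Fin.sum_univ_two, glCast, diagGL]
  · ring
  · linear_combination (-(d : ℝ)) * hxy'

/-- **Constant term of `(E_k^χ ∣_k α_M) ∣_k γ` at `i∞` when `M ∣ c`** (`gcd(M, N) = 1`,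
`k ≥ 3`): `M^{k-1} χ(d)(1 + χ(-1)(-1)^k)` if `N ∣ c`, else `0` — since `α_M γ = γ' α_M` with
`γ' = (a, Mb; c/M, d)`.  (Billerey–Menares Cor. 5, case `r = gcd(c, M) = M`, `χ₁ = 𝟙`; recall
`E_k^χ ∣_k α_M = M^{k-1} E_k^χ(M·)`.) [cite: BillereyMenares2018, Prop. 4 and Cor. 5] -/
theorem tendsto_eisensteinChar_slash_diagGL_slash_atImInfty_of_dvd (hk : 3 ≤ k)
    (hMN : M.Coprime N) {γ : SL(2, ℤ)} (hγ : (M : ℤ) ∣ γ 1 0) :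
    Tendsto ((eisensteinChar N k χ ∣[k] (glCast ((diagGL (M : ℚ) 1
        (Nat.cast_pos.mpr (NeZero.pos M)) one_pos : GL(2, ℚ)⁺) : GL (Fin 2) ℚ))) ∣[k] γ)
      atImInfty
      (𝓝 ((M : ℂ) ^ (k - 1) * (if ((γ 1 0 : ℤ) : ZMod N) = 0 then
        χ ((γ 1 1 : ℤ) : ZMod N) * (1 + χ (-1) * (-1) ^ k) else 0))) := by
  obtain ⟨c₁, hc₁⟩ := hγ
  have hdet : (!![γ 0 0, γ 0 1; (M : ℤ) * c₁, γ 1 1]).det = 1 := by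
    rw [← hc₁, Matrix.det_fin_two_of]
    have := Matrix.SpecialLinearGroup.det_coe γ
    rw [Matrix.det_fin_two] at this
    linear_combination this
  have hdet' : (!![γ 0 0, (M : ℤ) * γ 0 1; c₁, γ 1 1]).det = 1 := by
    rw [Matrix.det_fin_two_of] at hdet ⊢
    linear_combination hdet
  have hγeq : γ = (⟨!![γ 0 0, γ 0 1; (M : ℤ) * c₁, γ 1 1], hdet⟩ : SL(2, ℤ)) := by
    ext i j
    fin_cases i <;> fin_cases j <;> simp [hc₁]
  set γ' : SL(2, ℤ) := ⟨!![γ 0 0, (M : ℤ) * γ 0 1; c₁, γ 1 1], hdet'⟩ with hγ'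
  have hprod := glCast_diagGL_mul_mapGL_of_dvd M (γ 0 0) (γ 0 1) c₁ (γ 1 1) hdet hdet'
  rw [← hγeq] at hprod
  -- `(E ∣ α_M) ∣ γ = (E ∣ γ') ∣ α_M`
  have hslash : (eisensteinChar N k χ ∣[k] (glCast ((diagGL (M : ℚ) 1
      (Nat.cast_pos.mpr (NeZero.pos M)) one_pos : GL(2, ℚ)⁺) : GL (Fin 2) ℚ))) ∣[k] γ =
      (eisensteinChar N k χ ∣[k] γ') ∣[k] (glCast ((diagGL (M : ℚ) 1
        (Nat.cast_pos.mpr (NeZero.pos M)) one_pos : GL(2, ℚ)⁺) : GL (Fin 2) ℚ)) := by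
    rw [ModularForm.SL_slash, ModularForm.SL_slash, ← SlashAction.slash_mul,
      ← SlashAction.slash_mul]
    congr 1
  rw [hslash]
  have hlim := tendsto_eisensteinChar_slash_atImInfty χ hk γ'
  have h10 : (glCast ((diagGL (M : ℚ) 1 (Nat.cast_pos.mpr (NeZero.pos M)) one_pos :
      GL(2, ℚ)⁺) : GL (Fin 2) ℚ)) 1 0 = 0 := by simp [glCast, diagGL]
  have h := tendsto_slash_atImInfty_of_upperTriangular (k := k) h10 (det_glCast_pos _) hlim
  convert h using 2
  have hdetM : (((glCast ((diagGL (M : ℚ) 1 (Nat.cast_pos.mpr (NeZero.pos M)) one_pos :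
      GL(2, ℚ)⁺) : GL (Fin 2) ℚ)).det.val : ℝ) : ℂ) = M := by
    simp [glCast, Matrix.GeneralLinearGroup.map_det, diagGL, Matrix.det_fin_two]
  have h11 : (((glCast ((diagGL (M : ℚ) 1 (Nat.cast_pos.mpr (NeZero.pos M)) one_pos :
      GL(2, ℚ)⁺) : GL (Fin 2) ℚ)) 1 1 : ℝ) : ℂ) = 1 := by simp [glCast, diagGL]
  rw [hdetM, h11, _root_.one_zpow, mul_one]
  -- the conditions `N ∣ c₁` and `N ∣ M c₁` agree, and the `d`-entries agree
  have h10' : (γ' 1 0 : ℤ) = c₁ := by simp [hγ']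
  have h11' : (γ' 1 1 : ℤ) = γ 1 1 := by simp [hγ']
  have hcond : (((γ' 1 0 : ℤ) : ZMod N) = 0) ↔ (((γ 1 0 : ℤ) : ZMod N) = 0) := by
    have hu : IsUnit ((M : ZMod N)) := (ZMod.isUnit_iff_coprime M N).2 hMN
    rw [h10', hc₁, Int.cast_mul, Int.cast_natCast]
    exact hu.mul_right_eq_zero.symm
  simp only [h11', hcond]
  ring

/-- **Constant term of `(E_k^χ ∣_k α_M) ∣_k γ` at `i∞` when `gcd(c, M) = 1`** (`gcd(M, N) = 1`,
`k ≥ 3`): `M⁻¹ χ̄(M) χ(d) (1 + χ(-1)(-1)^k)` if `N ∣ c`, else `0` — since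
`α_M γ = γ' diag(1,M) T^t` with `γ' = (Ma, *; c, s)`, `sM ≡ d (mod N)` when `N ∣ c`, and
`diag(1, M)` contributes `M^{k-1} M^{-k}`.  (Billerey–Menares Cor. 5, case `r = gcd(c, M) = 1`,
`χ₁ = 𝟙`.) [cite: BillereyMenares2018, Prop. 4 and Cor. 5] -/
theorem tendsto_eisensteinChar_slash_diagGL_slash_atImInfty_of_isCoprime (hk : 3 ≤ k)
    (hMN : M.Coprime N) {γ : SL(2, ℤ)} (hγ : IsCoprime (γ 1 0) M) :
    Tendsto ((eisensteinChar N k χ ∣[k] (glCast ((diagGL (M : ℚ) 1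
        (Nat.cast_pos.mpr (NeZero.pos M)) one_pos : GL(2, ℚ)⁺) : GL (Fin 2) ℚ))) ∣[k] γ)
      atImInfty
      (𝓝 ((M : ℂ)⁻¹ * (if ((γ 1 0 : ℤ) : ZMod N) = 0 then
        χ⁻¹ (M : ZMod N) * χ ((γ 1 1 : ℤ) : ZMod N) * (1 + χ (-1) * (-1) ^ k) else 0))) := by
  obtain ⟨x, y, hxy⟩ := hγ
  have hdetγ : (!![γ 0 0, γ 0 1; γ 1 0, γ 1 1]).det = 1 := by
    rw [Matrix.det_fin_two_of]
    have := Matrix.SpecialLinearGroup.det_coe γ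
    rw [Matrix.det_fin_two] at this
    exact this
  have hγeq : γ = (⟨!![γ 0 0, γ 0 1; γ 1 0, γ 1 1], hdetγ⟩ : SL(2, ℤ)) := by
    ext i j
    fin_cases i <;> fin_cases j <;> simp
  have hdet' : (!![(M : ℤ) * γ 0 0, γ 0 1 - γ 0 0 * (x * γ 1 1); γ 1 0, γ 1 1 * y]).det = 1 := by
    rw [Matrix.det_fin_two_of] at hdetγ ⊢
    linear_combination (γ 0 0 * γ 1 1) * hxy + hdetγ
  have hT : (!![(1 : ℤ), x * γ 1 1; 0, 1]).det = 1 := by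
    rw [Matrix.det_fin_two_of]; ring
  set γ' : SL(2, ℤ) := ⟨!![(M : ℤ) * γ 0 0, γ 0 1 - γ 0 0 * (x * γ 1 1); γ 1 0, γ 1 1 * y], hdet'⟩
    with hγ'
  set T' : SL(2, ℤ) := ⟨!![(1 : ℤ), x * γ 1 1; 0, 1], hT⟩ with hT'
  have hprod := glCast_diagGL_mul_mapGL_of_isCoprime M (γ 0 0) (γ 0 1) (γ 1 0) (γ 1 1) x y
    hdetγ hxy hdet' hT
  rw [← hγeq] at hprod
  -- `(E ∣ α_M) ∣ γ = ((E ∣ γ') ∣ diag(1, M)) ∣ T'`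
  have hslash : (eisensteinChar N k χ ∣[k] (glCast ((diagGL (M : ℚ) 1
      (Nat.cast_pos.mpr (NeZero.pos M)) one_pos : GL(2, ℚ)⁺) : GL (Fin 2) ℚ))) ∣[k] γ =
      ((eisensteinChar N k χ ∣[k] γ') ∣[k] (glCast ((diagGL 1 (M : ℚ) one_pos
        (Nat.cast_pos.mpr (NeZero.pos M)) : GL(2, ℚ)⁺) : GL (Fin 2) ℚ))) ∣[k] T' := by
    rw [ModularForm.SL_slash, ModularForm.SL_slash, ModularForm.SL_slash,
      ← SlashAction.slash_mul, ← SlashAction.slash_mul, ← SlashAction.slash_mul]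
    congr 1
    rw [mul_assoc] at hprod
    exact hprod
  rw [hslash]
  have hlim := tendsto_eisensteinChar_slash_atImInfty χ hk γ'
  have h10 : (glCast ((diagGL 1 (M : ℚ) one_pos (Nat.cast_pos.mpr (NeZero.pos M)) :
      GL(2, ℚ)⁺) : GL (Fin 2) ℚ)) 1 0 = 0 := by simp [glCast, diagGL]
  have h := tendsto_slash_atImInfty_of_upperTriangular (k := k) h10 (det_glCast_pos _) hlim
  have hT10 : T' 1 0 = 0 := by simp [hT']
  have hT11 : T' 1 1 = 1 := by simp [hT']
  have h2 := tendsto_slash_SL2_atImInfty_of_upperTriangular (k := k) hT10 hT11 h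
  convert h2 using 2
  have hdetM : (((glCast ((diagGL 1 (M : ℚ) one_pos (Nat.cast_pos.mpr (NeZero.pos M)) :
      GL(2, ℚ)⁺) : GL (Fin 2) ℚ)).det.val : ℝ) : ℂ) = M := by
    simp [glCast, Matrix.GeneralLinearGroup.map_det, diagGL, Matrix.det_fin_two]
  have h11 : (((glCast ((diagGL 1 (M : ℚ) one_pos (Nat.cast_pos.mpr (NeZero.pos M)) :
      GL(2, ℚ)⁺) : GL (Fin 2) ℚ)) 1 1 : ℝ) : ℂ) = M := by simp [glCast, diagGL]
  have hM0 : (M : ℂ) ≠ 0 := by exact_mod_cast NeZero.ne M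
  rw [hdetM, h11]
  -- the lower rows: `γ' 1 0 = c`, `γ' 1 1 = d y` with `M (d y) ≡ d (mod N)` when `N ∣ c`
  have hc' : (γ' 1 0 : ℤ) = γ 1 0 := by simp [hγ']
  have hd' : (γ' 1 1 : ℤ) = γ 1 1 * y := by simp [hγ']
  rw [hc', hd', Int.cast_mul]
  split_ifs with hc
  · have hu : IsUnit ((M : ZMod N)) := (ZMod.isUnit_iff_coprime M N).2 hMN
    -- from `x c + y M = 1` and `c ≡ 0`: `y M = 1` in `ℤ/N`
    have hyM : (y : ZMod N) * (M : ZMod N) = 1 := by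
      have := congrArg ((↑) : ℤ → ZMod N) hxy
      push_cast at this
      rw [hc, mul_zero, zero_add] at this
      exact this
    have hχy : χ (y : ZMod N) = χ⁻¹ (M : ZMod N) := by
      rw [MulChar.inv_apply_eq_inv']
      refine (eq_inv_of_mul_eq_one_left ?_)
      rw [← map_mul, hyM, map_one]
    rw [map_mul, hχy]
    have hk1 : (M : ℂ) ^ (k - 1) * (M : ℂ) ^ (-k) = (M : ℂ)⁻¹ := by
      rw [← zpow_add₀ hM0, show k - 1 + -k = -1 by ring, _root_.zpow_neg_one]
    calc _ = (M : ℂ) ^ (k - 1) * (M : ℂ) ^ (-k) *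
          (χ⁻¹ (M : ZMod N) * χ ((γ 1 1 : ℤ) : ZMod N) * (1 + χ (-1) * (-1) ^ k)) := by
          rw [hk1]
      _ = _ := by ring
  · simp

end Degeneracy

/-! ### The level-raising combination `F = E_k^χ - M^{1-k} (E_k^χ ∣ α_M) = E_k^χ - E_k^χ(M·)` -/

section LevelRaise

variable {N : ℕ} [NeZero N] {k : ℤ} (χ : DirichletCharacter ℂ N) (M : ℕ) [NeZero M]

/-- Slashing the combination `E - c • (E ∣ α)` by `γ ∈ SL₂(ℤ)`. [folklore] -/
theorem sub_smul_slash_SL2 (E G : ℍ → ℂ) (c : ℂ) (γ : SL(2, ℤ)) :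
    (E - c • G) ∣[k] γ = E ∣[k] γ - c • (G ∣[k] γ) := by
  ext τ
  simp only [ModularForm.SL_slash_apply, Pi.sub_apply, Pi.smul_apply, smul_eq_mul]
  ring

/-- **At the cusps `γ∞` with `M ∣ c` the constant term of `F ∣_k γ` vanishes**, where
`F = E_k^χ - M^{1-k}(E_k^χ ∣_k α_M) = E_k^χ - E_k^χ(M·)` (`gcd(M, N) = 1`, `k ≥ 3`):
Billerey–Menares §3.2, `a_0(F_2 ∣_k γ) = Υ(γ,1)(1 - (r/M)^k(χ₁χ̄₂)(M/r))` with `r = M`,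
`χ₁ = 𝟙`. [cite: BillereyMenares2018, Cor. 5 and §3.2] -/
theorem tendsto_levelRaise_slash_atImInfty_of_dvd (hk : 3 ≤ k) (hMN : M.Coprime N)
    {γ : SL(2, ℤ)} (hγ : (M : ℤ) ∣ γ 1 0) :
    Tendsto ((eisensteinChar N k χ - (M : ℂ) ^ (1 - k) • (eisensteinChar N k χ ∣[k]
        (glCast ((diagGL (M : ℚ) 1 (Nat.cast_pos.mpr (NeZero.pos M)) one_pos : GL(2, ℚ)⁺) :
          GL (Fin 2) ℚ)))) ∣[k] γ) atImInfty (𝓝 0) := by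
  rw [sub_smul_slash_SL2]
  have h1 := tendsto_eisensteinChar_slash_atImInfty χ hk γ
  have h2 := (tendsto_eisensteinChar_slash_diagGL_slash_atImInfty_of_dvd χ M hk hMN hγ).const_smul
    ((M : ℂ) ^ (1 - k))
  have h := h1.sub h2
  have hM0 : (M : ℂ) ≠ 0 := by exact_mod_cast NeZero.ne M
  convert h using 2
  · simp [smul_eq_mul]
  · rw [smul_eq_mul, ← mul_assoc, ← zpow_add₀ hM0, show 1 - k + (k - 1) = 0 by ring, zpow_zero,
      one_mul, sub_self]

/-- **At the cusps `γ∞` with `gcd(c, M) = 1` the constant term of `F ∣_k γ` is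
`χ(d)(1 + χ(-1)(-1)^k)(1 - χ̄(M) M^{-k}) [N ∣ c]`**, where
`F = E_k^χ - M^{1-k}(E_k^χ ∣_k α_M) = E_k^χ - E_k^χ(M·)` (`gcd(M, N) = 1`, `k ≥ 3`):
Billerey–Menares §3.2, `a_0(F_2 ∣_k γ) = Υ(γ,1)(1 - (r/M)^k(χ₁χ̄₂)(M/r))` with `r = 1`,
`χ₁ = 𝟙` — so all constant terms of `F` vanish modulo a prime above `p` exactly when
`χ(M) M^k ≡ 1`. [cite: BillereyMenares2018, Cor. 5 and §3.2] -/
theorem tendsto_levelRaise_slash_atImInfty_of_isCoprime (hk : 3 ≤ k) (hMN : M.Coprime N)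
    {γ : SL(2, ℤ)} (hγ : IsCoprime (γ 1 0) M) :
    Tendsto ((eisensteinChar N k χ - (M : ℂ) ^ (1 - k) • (eisensteinChar N k χ ∣[k]
        (glCast ((diagGL (M : ℚ) 1 (Nat.cast_pos.mpr (NeZero.pos M)) one_pos : GL(2, ℚ)⁺) :
          GL (Fin 2) ℚ)))) ∣[k] γ) atImInfty
      (𝓝 (if ((γ 1 0 : ℤ) : ZMod N) = 0 then
        χ ((γ 1 1 : ℤ) : ZMod N) * (1 + χ (-1) * (-1) ^ k) * (1 - χ⁻¹ (M : ZMod N) * (M : ℂ) ^ (-k))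
        else 0)) := by
  rw [sub_smul_slash_SL2]
  have h1 := tendsto_eisensteinChar_slash_atImInfty χ hk γ
  have h2 := (tendsto_eisensteinChar_slash_diagGL_slash_atImInfty_of_isCoprime χ M hk hMN
    hγ).const_smul ((M : ℂ) ^ (1 - k))
  have h := h1.sub h2
  have hM0 : (M : ℂ) ≠ 0 := by exact_mod_cast NeZero.ne M
  convert h using 2
  · simp [smul_eq_mul]
  · split_ifs with hc
    · rw [smul_eq_mul, ← mul_assoc, ← _root_.zpow_neg_one (M : ℂ), ← zpow_add₀ hM0,
        show 1 - k + -1 = -k by ring]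
      ring
    · simp

/-- For a prime `M`, every `γ ∈ SL₂(ℤ)` falls under one of the two cases `M ∣ c`,
`gcd(c, M) = 1`. [folklore] -/
theorem dvd_or_isCoprime_of_prime {M : ℕ} (hM : M.Prime) (c : ℤ) :
    (M : ℤ) ∣ c ∨ IsCoprime c M :=
  (dvd_or_isCoprime (M : ℤ) c (Nat.prime_iff_prime_int.1 hM).irreducible).imp id IsCoprime.symm

end LevelRaise

end Literature.NumberTheory.EllipticCurves.ModularForms
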